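import Mathlib
import HarnessLib
import Summits.RiemannHypothesis.Statement
import Summits.RiemannHypothesis.RiemannHypothesis.Theses.MayerPairing

/-!
# RiemannHypothesis / MayerPairing — structure of the target `Target`

Route `RiemannHypothesis/MayerPairing`, item stmt-RiemannHypothesis-1473 (`Target`, rank 0):
the thesis `X = UnitCircleCrossedOnce ∧ BranchPairing` (both conjuncts inlined verbatim in the
route file).

This file records, kernel-checked, the logical position of `Target` relative to its two cruxes and
to the summit statement:

* `mayerPairing_target_iff` : `Target ↔ UnitCircleCrossedOnce ∧ BranchPairing` (definitional);
* `mayerPairing_closes` : `UnitCircleCrossedOnce → BranchPairing → NontrivialZeroLocus → RH` — the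
  route's former deciding theorem `closes`, re-homed here when the route was CLOSED (retired,
  2026-08-16T08:47Z) and the regenerated route file dropped it (fullbuild repair 2026-08-16);
* `mayerPairing_riemannHypothesis_of_target` : `Target → NontrivialZeroLocus → RH`
  (through `mayerPairing_closes`);
* `mayerPairing_branchPairing_of_riemannHypothesis` : `EisensteinEigenvalueOne → RH → BranchPairing`
  — under RH the pairing segment `[Re ρ/2, (1 - Re ρ)/2]` degenerates to the point `σ = 1/4`, and the
  constant selection `Λ ≡ 1` is an eigenvalue selection by the dictionary at `s = ρ/2`;
* `mayerPairing_target_iff_of_dictionary` : given the dictionary and the zero-locus bookkeeping,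
  `Target ↔ UnitCircleCrossedOnce ∧ RH` — i.e. the thesis is stronger than RH by exactly the
  ζ-free monotonicity conjunct, as the route card asserts informally.

No new definitions; Mathlib-only apart from the route file. References: D. Mayer, Bull. AMS 25
(1991) 55–60, Thm 2; C.-H. Chang and D. Mayer, in *Dynamical, Spectral and Arithmetic Zeta
Functions*, Contemp. Math. 290 (2001), Prop. 4.1(v).
-/

namespace Summit.RiemannHypothesis.RiemannHypothesis.Theorems

open Summit.RiemannHypothesis.RiemannHypothesis.Theses.MayerPairing

/-- The target of route MayerPairing is, definitionally, the conjunction of its two cruxes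
`UnitCircleCrossedOnce` (item 1470) and `BranchPairing` (item 1471). [folklore] -/
theorem mayerPairing_target_iff : Target ↔ UnitCircleCrossedOnce ∧ BranchPairing := Iff.rfl

/-- Both cruxes together give the target (item 1473 from items 1470 and 1471). [folklore] -/
theorem mayerPairing_target_of (hU : UnitCircleCrossedOnce) (hB : BranchPairing) : Target :=
  ⟨hU, hB⟩

/-- A refutation of the monotonicity crux `UnitCircleCrossedOnce` refutes the target. [folklore] -/
theorem mayerPairing_not_target_of_not_unitCircleCrossedOnce (hU : ¬ UnitCircleCrossedOnce) :
    ¬ Target :=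
  fun h => hU h.1

/-- A refutation of the pairing crux `BranchPairing` refutes the target. [folklore] -/
theorem mayerPairing_not_target_of_not_branchPairing (hB : ¬ BranchPairing) : ¬ Target :=
  fun h => hB h.2

/-- **The former deciding theorem of route MayerPairing, re-homed** (the route was CLOSED `retired` on
2026-08-16T08:47Z — kill criterion K1, `UnitCircleCrossedOnce` numerically false — and the regenerated
route file no longer carries `closes`; fullbuild repair 2026-08-16, proof = the planner's kernel-checked
`closes` in its three-binder form). `UnitCircleCrossedOnce → BranchPairing → NontrivialZeroLocus → RH`:
a zero `s` (non-trivial, `s ≠ 1`) has `0 < re s < 1`, `14 < |im s|` by the bookkeeping hypothesis; move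
it into the quarter `0 < re ρ ≤ 1/2`, `14 < im ρ` by `s ↦ 1 - s` (`riemannZeta_one_sub`) and
`ρ ↦ conj ρ` (`riemannZeta_conj`); if `re ρ < 1/2`, `BranchPairing` gives a continuous eigenvalue
selection `Λ` on `[re ρ/2, (1 - re ρ)/2]` with `Λ = 1` at both endpoints, and `UnitCircleCrossedOnce`
at height `τ = im ρ/2 ≥ 7` forbids `‖Λ a‖ = 1 ∧ ‖Λ b‖ = 1` — contradiction; so `re ρ = 1/2`, hence
`re s = 1/2`. [folklore] -/
theorem mayerPairing_closes (hU : UnitCircleCrossedOnce) (hB : BranchPairing)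
    (hL : NontrivialZeroLocus) : _root_.Summit.RiemannHypothesis := by
  -- the core step: a zero in the closed left half of the upper critical strip lies on the line
  have key : ∀ ρ : ℂ, riemannZeta ρ = 0 → 0 < ρ.re → ρ.re ≤ 1 / 2 → 14 < ρ.im → ρ.re = 1 / 2 := by
    intro ρ hρ h0 hhalf h14
    by_contra hne
    have hlt : ρ.re < 1 / 2 := lt_of_le_of_ne hhalf hne
    obtain ⟨Λ, hcont, ha, hb, heig⟩ := hB ρ hρ h0 hhalf h14
    have hτpos : 0 < ρ.im / 2 := by linarith
    have hτ : (7 : ℝ) ≤ |ρ.im / 2| := by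
      rw [abs_of_pos hτpos]
      linarith
    exact hU (ρ.im / 2) hτ (ρ.re / 2) ((1 - ρ.re) / 2) (by linarith) (by linarith) (by linarith)
      Λ hcont heig ⟨by rw [ha, norm_one], by rw [hb, norm_one]⟩
  -- conjugation symmetry: reduce `14 < |im ρ|` to `14 < im ρ`
  have lift : ∀ ρ : ℂ, riemannZeta ρ = 0 → 0 < ρ.re → ρ.re ≤ 1 / 2 → 14 < |ρ.im| →
      ρ.re = 1 / 2 := by
    intro ρ hρ h0 hhalf h14
    rcases lt_or_ge 0 ρ.im with hpos | hnonpos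
    · exact key ρ hρ h0 hhalf (by rwa [abs_of_pos hpos] at h14)
    · have hconj : riemannZeta (starRingEnd ℂ ρ) = 0 := by
        rw [riemannZeta_conj, hρ]
        simp
      have h14' : 14 < (starRingEnd ℂ ρ).im := by
        rw [Complex.conj_im]
        rwa [abs_of_nonpos hnonpos] at h14
      have h0' : 0 < (starRingEnd ℂ ρ).re := by rwa [Complex.conj_re]
      have hhalf' : (starRingEnd ℂ ρ).re ≤ 1 / 2 := by rwa [Complex.conj_re]
      have := key (starRingEnd ℂ ρ) hconj h0' hhalf' h14'
      rwa [Complex.conj_re] at this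
  -- the statement itself
  intro s hs htriv h1
  obtain ⟨hre0, hre1, him⟩ := hL s hs htriv h1
  rcases le_or_gt s.re (1 / 2) with hle | hgt
  · exact lift s hs hre0 hle him
  · -- functional equation: pass to the zero `1 - s`
    have hnat : ∀ n : ℕ, s ≠ -(n : ℂ) := by
      intro n h
      have hre : s.re = -(n : ℝ) := by
        rw [h, Complex.neg_re, Complex.natCast_re]
      have hn : (0 : ℝ) ≤ n := n.cast_nonneg
      linarith
    have hsub : riemannZeta (1 - s) = 0 := by
      rw [riemannZeta_one_sub hnat h1, hs, mul_zero]
    have h0' : 0 < (1 - s).re := by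
      rw [Complex.sub_re, Complex.one_re]
      linarith
    have hhalf' : (1 - s).re ≤ 1 / 2 := by
      rw [Complex.sub_re, Complex.one_re]
      linarith
    have him' : 14 < |(1 - s).im| := by
      rw [Complex.sub_im, Complex.one_im, zero_sub, abs_neg]
      exact him
    have h := lift (1 - s) hsub h0' hhalf' him'
    rw [Complex.sub_re, Complex.one_re] at h
    linarith

/-- The target implies the Riemann Hypothesis, given the (in-tree, elementary) ζ-side bookkeeping
`NontrivialZeroLocus` — the route's former deciding theorem (`mayerPairing_closes`) applied to the two
conjuncts. [folklore] -/
theorem mayerPairing_riemannHypothesis_of_target (hT : Target) (hL : NontrivialZeroLocus) :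
    _root_.Summit.RiemannHypothesis :=
  mayerPairing_closes hT.1 hT.2 hL

/-- **RH ⇒ pairing, given the dictionary.** If every zero `ρ` of `ζ` with `0 < Re ρ ≤ 1/2` and
`Im ρ > 14` lies on the critical line, then the pairing segment `[Re ρ/2, (1 - Re ρ)/2]` at height
`Im ρ/2` is the single point `σ = 1/4`, and the constant selection `Λ ≡ 1` is an eigenvalue selection
of Mayer's `L_{σ + i Im ρ/2}` there because `2 · (1/4 + i Im ρ/2) = ρ` is a zero of `ζ`
(the dictionary `EisensteinEigenvalueOne`, Chang–Mayer 2001 Prop. 4.1(v)). Hence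
`BranchPairing` is no stronger than RH modulo the dictionary. [folklore] -/
theorem mayerPairing_branchPairing_of_riemannHypothesis (hD : EisensteinEigenvalueOne)
    (hRH : _root_.Summit.RiemannHypothesis) : BranchPairing := by
  intro ρ hζ h0 hhalf h14
  -- `ρ` is a nontrivial zero, hence on the critical line
  have htriv : ¬ ∃ n : ℕ, ρ = -2 * (n + 1) := by
    rintro ⟨n, hn⟩
    have hre : ρ.re = -2 * (n + 1) := by
      rw [hn]
      simp
    have hn0 : (0 : ℝ) ≤ n := n.cast_nonneg
    linarith
  have hne1 : ρ ≠ 1 := by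
    intro h1
    rw [h1, Complex.one_re] at hhalf
    norm_num at hhalf
  have hline : ρ.re = 1 / 2 := hRH ρ hζ htriv hne1
  refine ⟨fun _ => 1, continuousOn_const, rfl, rfl, fun σ hσ => ?_⟩
  -- on the degenerate segment, `σ = 1/4`
  obtain ⟨hσ1, hσ2⟩ := hσ
  have hσ : σ = 1 / 4 := by
    rw [hline] at hσ1 hσ2
    apply le_antisymm <;> linarith
  -- the dictionary at `s = σ + i Im ρ / 2 = ρ / 2`
  set s : ℂ := (σ : ℂ) + ((ρ.im / 2 : ℝ) : ℂ) * Complex.I with hs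
  have hsre : s.re = σ := by
    simp [hs]
  have h2s : 2 * s = ρ := by
    apply Complex.ext
    · simp [hs, hline, hσ]
      norm_num
    · simp [hs]
      ring
  have hs0 : 0 < s.re := by
    rw [hsre, hσ]
    norm_num
  have hs1 : s.re < 1 / 2 := by
    rw [hsre, hσ]
    norm_num
  have hζ2 : riemannZeta (2 * s) = 0 := by
    rw [h2s, hζ]
  obtain ⟨f, δ, hδ, hdiff, hnz, hfe, hlim⟩ := hD s hs0 hs1 hζ2
  exact ⟨f, δ, hδ, hdiff, hnz, hfe, hlim⟩

/-- **The thesis is RH plus exactly the monotonicity crux.** Given the dictionary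
`EisensteinEigenvalueOne` (Chang–Mayer 2001, Prop. 4.1(v); item 1469) and the ζ-side bookkeeping
`NontrivialZeroLocus` (item 9431), the target `Target = UnitCircleCrossedOnce ∧ BranchPairing`
is equivalent to `UnitCircleCrossedOnce ∧ RH`: forward by the former deciding theorem
(`mayerPairing_closes`),
backward because RH degenerates every pairing segment to the point `ρ/2` where the dictionary
supplies the eigenvalue `1`. So the route's surplus over RH is precisely the ζ-free statement
`UnitCircleCrossedOnce` about the moduli of Mayer's eigenvalue branches. [folklore] -/
theorem mayerPairing_target_iff_of_dictionary (hD : EisensteinEigenvalueOne)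
    (hL : NontrivialZeroLocus) :
    Target ↔ (UnitCircleCrossedOnce ∧ _root_.Summit.RiemannHypothesis) :=
  ⟨fun hT => ⟨hT.1, mayerPairing_closes hT.1 hT.2 hL⟩,
    fun h => ⟨h.1, mayerPairing_branchPairing_of_riemannHypothesis hD h.2⟩⟩

end Summit.RiemannHypothesis.RiemannHypothesis.Theorems
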